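import Summits.AtomisticToContinuum.HydrodynamicLimit.Theorems.OneFlightGossipEngineEnergyCurrentTailsLevelCensusSplitFloorRung0Statics
import Literature.MathematicalPhysics.KineticTheory.HardSphereTwoTimePressure
import HarnessLib

/-!
# Statics of the pair excess under the hot-spot law (stub G of the rung-½ refutation, line
# `level-census-comparison`, crux `EnergyCurrentTails`, stmt-AtomisticToContinuum-9235)

At fixed `N`, under the inhomogeneous local Gibbs law `λhot` with constant activity `a`, zero drift and the
hot-spot temperature profile `θhot x = 2 − ‖x‖ ∈ [3/2, 2]` (`‖x‖ ≤ 1/2` on `𝕋³`), the expected PAIR EXCESS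
`Σ_{p ∈ W_h(z)} #{q ∈ W_h(z) : q ∉ {p, p.swap}}` of the ordered would-be pairs `W_h(z) = wouldBePairs ε_N h z` of
the window `(0, h]` is `O_N(h²)`:

* GIVEN the law domination (stub A, taken as a hypothesis) `λhot ≤ K • λhom`, `K = ((2/(3/2))^{3/2})^{N+1}`,
  with `λhom` the homogeneous law at temperature `2`;
* `λhot`-a.e. configuration is good, hence in the hard-sphere domain (`ae_mem_good_localGibbsLaw`,
  `HardSphereFlow.good_subset`), where the pair excess is below the measurable majorant `M` of the tree's
  rung-0 statics `EnergyCurrentTailsLevelCensus.splitFloorRung0_statics` (at `θ = 2`, `u = 0`), whose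
  `λhom`-mean is `≤ ((N+1)⁷ + (N+1)⁸) · 1024 ε_N⁴ · 6 · h²`.
-/

noncomputable section

open MeasureTheory Set Filter
open scoped ENNReal InnerProductSpace BigOperators Classical

namespace Summit.AtomisticToContinuum.HydrodynamicLimit.Theorems.EnergyCurrentTailsRungHalf

open Literature.MathematicalPhysics.KineticTheory Literature.Analysis.FluidPDE
open Summit.AtomisticToContinuum.HydrodynamicLimit.Theorems.RateFloorLine

/-- **Stub G — statics of the pair excess under the hot-spot law** (given the law domination, stub A, as the
first hypothesis): at fixed `N` the expected pair excess of the would-be pairs of the window `(0, h]` under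
`λ_{a, 0, 2 − ‖·‖}` is at most `C h²` for every `h > 0`, with
`C = ((2/(3/2))^{3/2})^{N+1} · ((N+1)⁷ + (N+1)⁸) · 1024 ε_N⁴ · 6` (domination by the homogeneous law at
`θ = 2`, then `splitFloorRung0_statics`). [folklore] -/
theorem stub_overlapStatics :
    (∀ (σ a : ℝ) (u : V3) (θ₀ : T3 → ℝ) (θmin θmax : ℝ), Continuous θ₀ → 0 < θmin →
      (∀ x, θmin ≤ θ₀ x) → (∀ x, θ₀ x ≤ θmax) → 0 < a →
      ∀ (N : ℕ) (Φ : HardSphereFlow (Torus.geometry (Fin 3)) (hsDiameter σ N) (N + 1)),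
        localGibbsLaw σ (fun _ => a) (fun _ => u) θ₀ N Φ ≤
          ENNReal.ofReal (((θmax / θmin) ^ ((3 : ℝ) / 2)) ^ (N + 1)) •
            localGibbsLaw σ (fun _ => a) (fun _ => u) (fun _ => θmax) N Φ) →
    ∀ (σ : ℝ), SmallDensity uniformProfile σ → ∀ (a : ℝ), 0 < a →
      ∀ (N : ℕ) (Φ : HardSphereFlow (Torus.geometry (Fin 3)) (hsDiameter σ N) (N + 1)),
        ∃ C : ℝ, 0 ≤ C ∧ ∀ h : ℝ, 0 < h →
          ∫⁻ z, ((∑ p ∈ wouldBePairs (hsDiameter σ N) h z,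
              ((wouldBePairs (hsDiameter σ N) h z).filter fun q => q ≠ p ∧ q ≠ p.swap).card : ℕ) : ℝ≥0∞)
            ∂(localGibbsLaw σ (fun _ => a) (fun _ => (0 : V3)) (fun x => 2 - ‖x‖) N Φ) ≤
          ENNReal.ofReal (C * h ^ 2) := by
  intro hdom σ hsd a ha N Φ
  have hσ : 0 < σ := hsd.σ_pos
  have hσ2 : σ ≤ 1 / 2 := hsd.σ_lt_half.le
  -- the domination constant and the statics constant
  set K : ℝ := (((2 : ℝ) / (3 / 2)) ^ ((3 : ℝ) / 2)) ^ (N + 1) with hK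
  have hK0 : 0 ≤ K := by positivity
  set A : ℝ := (((N + 1 : ℕ) : ℝ) ^ 7 + ((N + 1 : ℕ) : ℝ) ^ 8) *
    (1024 * hsDiameter σ N ^ 4 * (‖(0 : V3)‖ ^ 2 + 3 * 2)) with hA
  have hA0 : 0 ≤ A := by positivity
  refine ⟨K * A, mul_nonneg hK0 hA0, fun h hh => ?_⟩
  -- the hot-spot profile is continuous with values in `[3/2, 2]`
  have hθcont : Continuous fun x : T3 => (2 : ℝ) - ‖x‖ := continuous_const.sub continuous_norm
  have hθlo : ∀ x : T3, (3 / 2 : ℝ) ≤ 2 - ‖x‖ := fun x => by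
    have hx := Literature.Analysis.FunctionSpaces.Torus.norm_le_half x
    linarith
  have hθhi : ∀ x : T3, (2 : ℝ) - ‖x‖ ≤ 2 := fun x => by linarith [norm_nonneg x]
  -- law domination (stub A): `λhot ≤ K • λhom`
  have hle : localGibbsLaw σ (fun _ => a) (fun _ => (0 : V3)) (fun x => 2 - ‖x‖) N Φ ≤
      ENNReal.ofReal K • localGibbsLaw σ (fun _ => a) (fun _ => (0 : V3)) (fun _ => (2 : ℝ)) N Φ :=
    hdom σ a (0 : V3) (fun x => 2 - ‖x‖) (3 / 2) 2 hθcont (by norm_num) hθlo hθhi ha N Φ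
  -- rung-0 statics under the homogeneous law at `θ = 2`, `u = 0`
  obtain ⟨M, hMm, hMge, hMint⟩ := EnergyCurrentTailsLevelCensus.splitFloorRung0_statics σ hσ hσ2 hsd a 2 ha
    (by norm_num) (0 : V3) N Φ h hh
  -- `λhot`-a.e. configuration lies in the hard-sphere domain, where the excess is below `M`
  have hae : ∀ᵐ z ∂(localGibbsLaw σ (fun _ => a) (fun _ => (0 : V3)) (fun x => 2 - ‖x‖) N Φ),
      ((∑ p ∈ wouldBePairs (hsDiameter σ N) h z,
          ((wouldBePairs (hsDiameter σ N) h z).filter fun q => q ≠ p ∧ q ≠ p.swap).card : ℕ) : ℝ≥0∞) ≤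
        M z := by
    filter_upwards [ae_mem_good_localGibbsLaw σ (fun _ => a) (fun _ => (0 : V3)) (fun x => 2 - ‖x‖) N Φ]
      with z hz
    exact hMge z (Φ.good_subset hz)
  calc ∫⁻ z, ((∑ p ∈ wouldBePairs (hsDiameter σ N) h z,
          ((wouldBePairs (hsDiameter σ N) h z).filter fun q => q ≠ p ∧ q ≠ p.swap).card : ℕ) : ℝ≥0∞)
        ∂(localGibbsLaw σ (fun _ => a) (fun _ => (0 : V3)) (fun x => 2 - ‖x‖) N Φ)
      ≤ ∫⁻ z, M z ∂(localGibbsLaw σ (fun _ => a) (fun _ => (0 : V3)) (fun x => 2 - ‖x‖) N Φ) :=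
        lintegral_mono_ae hae
    _ ≤ ∫⁻ z, M z ∂(ENNReal.ofReal K • localGibbsLaw σ (fun _ => a) (fun _ => (0 : V3)) (fun _ => (2 : ℝ)) N Φ) :=
        lintegral_mono' hle le_rfl
    _ = ENNReal.ofReal K * ∫⁻ z, M z ∂(localGibbsLaw σ (fun _ => a) (fun _ => (0 : V3)) (fun _ => (2 : ℝ)) N Φ) := by
        rw [lintegral_smul_measure, smul_eq_mul]
    _ ≤ ENNReal.ofReal K * ENNReal.ofReal ((((N + 1 : ℕ) : ℝ) ^ 7 + ((N + 1 : ℕ) : ℝ) ^ 8) *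
          (1024 * hsDiameter σ N ^ 4 * (‖(0 : V3)‖ ^ 2 + 3 * 2) * h ^ 2)) := by
        gcongr
    _ = ENNReal.ofReal (K * A * h ^ 2) := by
        rw [← ENNReal.ofReal_mul hK0, hA]
        congr 1
        ring

end Summit.AtomisticToContinuum.HydrodynamicLimit.Theorems.EnergyCurrentTailsRungHalf

end
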